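import Summits.CriticalPhenomena.PercolationContinuityZ3.Theorems.PercNecklaceBackboneTruncatedSusceptibilityFiniteOfThetaOfCritical
import Summits.CriticalPhenomena.PercolationContinuityZ3.Theorems.PercNecklaceBackboneTruncatedSusceptibilityFiniteOfThetaOfBlockingSum
import Summits.CriticalPhenomena.PercolationContinuityZ3.Theorems.PercNecklaceBackboneTruncatedSusceptibilityFiniteOfThetaOfSupercriticalLimit
import HarnessLib

/-!
# Strategist sketch (cstrat s2) for crux `TruncatedSusceptibilityFiniteOfTheta` (stmt-CriticalPhenomena-0852)

Typed material for `STRATEGY-CENSUS.md` — NOT a registered line, NOT a filed split.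

* `## Decomposition`: the best typed split found, `SubBlockingSummable ∧ SubGluing → crux`
  (`crux_of_subs`, proved), together with the proofs that BOTH pieces are consequences of the crux
  (`subBlockingSummable_of_crux`, `subGluing_of_crux`), i.e. the split is a conjunct split
  `crux ↔ Sub₁ ∧ Sub₂`; the census explains why `SubGluing` remains the whole crux.
* `## Strengthen`: the typed strengthening `SupChiNearCritical` (uniform truncated susceptibility just
  above `p_c` under the jump hypothesis); its radius analogue is the hypothesis of the landed
  `stub_criticalRadiusMoment_of_supercriticalDomination` (p154083).
-/

noncomputable section

namespace Summit.CriticalPhenomena.PercolationContinuityZ3.Cruxes.TruncatedSusceptibilityFiniteOfTheta.Strategist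

open MeasureTheory Filter Topology
open Literature.Probability.Percolation Literature.Probability.LatticeModels
open Summit.CriticalPhenomena.PercolationContinuityZ3.Theorems.SubpolynomialBlocking.Negative (blockProb)
open Summit.CriticalPhenomena.PercolationContinuityZ3.Theorems.TruncatedSusceptibilityFiniteOfTheta

/-- The crux, by name (route spelling `PercNecklaceBackbone`). -/
abbrev Crux : Prop :=
  Summit.CriticalPhenomena.PercolationContinuityZ3.Theses.PercNecklaceBackbone.TruncatedSusceptibilityFiniteOfTheta

/-- `J`: the jump hypothesis `θ(p_c) > 0` on `ℤ³`. -/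
def Jump : Prop := 0 < theta (zdGraph 3) (0 : Site 3) (criticalProbI 3)

/-- `χᶠ(p_c) < ∞` in the crux's spelling. -/
def ChiFiniteCritical : Prop :=
  Summable fun x : Site 3 => (bondPercolation (zdGraph 3) (criticalProbI 3)).real (openConn 0 x \ percolatesAt 0)

/-- **Sub₁ (hole tails of the infinite cluster).** Under `J`, critical annulus blocking is summable:
`Σ_n u_n(p_c) < ∞`, `u_n = P_{p_c}(no open crossing of Λ_{2n} ∖ Λ_n inside Λ_{2n})`. -/
def SubBlockingSummable : Prop := Jump → Summable fun n : ℕ => blockProb 3 (criticalProbI 3) n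

/-- **Sub₂ (gluing).** Under `J` AND summable critical blocking, finite clusters at `p_c` are thin. -/
def SubGluing : Prop := Jump → (Summable fun n : ℕ => blockProb 3 (criticalProbI 3) n) → ChiFiniteCritical

/-- The assembly of the split (modus ponens through `L ⟺ L(p_c)`, p150587). -/
theorem crux_of_subs (h₁ : SubBlockingSummable) (h₂ : SubGluing) : Crux :=
  TruncatedSusceptibilityFiniteOfTheta_iff_critical.mpr fun hJ => h₂ hJ (h₁ hJ)

/-- Sub₁ is a consequence of the crux (radius quarantine sandwich, p158555/p158780). -/
theorem subBlockingSummable_of_crux (h : Crux) : SubBlockingSummable := fun hJ =>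
  summable_blockProb_of_truncatedSusceptibility (criticalProbI 3) hJ
    (TruncatedSusceptibilityFiniteOfTheta_iff_critical.mp h hJ)

/-- Sub₂ is a consequence of the crux (trivially). -/
theorem subGluing_of_crux (h : Crux) : SubGluing := fun hJ _ =>
  TruncatedSusceptibilityFiniteOfTheta_iff_critical.mp h hJ

/-- So the split is a conjunct split: `crux ↔ Sub₁ ∧ Sub₂`. -/
theorem crux_iff_subs : Crux ↔ SubBlockingSummable ∧ SubGluing :=
  ⟨fun h => ⟨subBlockingSummable_of_crux h, subGluing_of_crux h⟩, fun h => crux_of_subs h.1 h.2⟩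

/-- **S⁺ (uniform truncated susceptibility just above `p_c`, volume form).** Under `J` there are
`δ > 0` and `M` with `χᶠ(p) ≤ M` for all `p ∈ (p_c, p_c + δ)`. By lower semicontinuity of
`p ↦ P_p(0 ↔ x, |C| < ∞)` and Fatou this gives `χᶠ(p_c) ≤ M`, hence the crux; the radius analogue
is the hypothesis of the landed `stub_criticalRadiusMoment_of_supercriticalDomination` (p154083). -/
def SupChiNearCritical : Prop :=
  Jump → ∃ δ : ℝ, 0 < δ ∧ ∃ M : ℝ, ∀ p : unitInterval,
    criticalProb (zdGraph 3) (0 : Site 3) < (p : ℝ) → (p : ℝ) < criticalProb (zdGraph 3) (0 : Site 3) + δ →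
      (Summable fun x : Site 3 => (bondPercolation (zdGraph 3) p).real (openConn 0 x \ percolatesAt 0)) ∧
        (∑' x : Site 3, (bondPercolation (zdGraph 3) p).real (openConn 0 x \ percolatesAt 0)) ≤ M

/-- **S⁺⁺ (exponential radius decay at every percolating `p`, = crux 0853's `p_c` instance).** -/
def ExpRadiusDecayAtCritical : Prop :=
  Jump → ∃ c : ℝ, 0 < c ∧ ∀ n : ℕ,
    (bondPercolation (zdGraph 3) (criticalProbI 3)).real (siteToBoundary 3 n \ percolatesAt 0) ≤ Real.exp (-(c * n))

end Summit.CriticalPhenomena.PercolationContinuityZ3.Cruxes.TruncatedSusceptibilityFiniteOfTheta.Strategist
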